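import Literature.NumberTheory.DiophantineGeometry.GenEllKummerTower
import Literature.NumberTheory.DiophantineGeometry.GenEllThm21
import Literature.NumberTheory.DiophantineGeometry.GenEllNorthcott
import Literature.NumberTheory.EllipticCurves.HeightsBaseChangeProofs
import HarnessLib

/-!
# [GenEll] Thm. 2.1, proof, Step 1 for `ℙ¹`: reduction to the Fermat coverings (`D = ∅`)

S. Mochizuki, *Arithmetic elliptic curves in general position*, Math. J. Okayama Univ. 52 (2010)
[cite: MochizukiGenEll2010], proof of Thm. 2.1, pp. 11–12, read on the page: "for any positive integer
`e`, there exists a connected finite étale Galois covering `U_Y → U_X`, such that … `Y → X` is ramified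
at each point of `E` with ramification index equal to `e` … Write `d′ = d · deg(Y/X)`. Then I claim
that to complete the proof of the implication "(ii) ⟹ (i)", it suffices to verify the inequality
`ht_{ω_Y} ≲ (1 + ε′) · log-diff_Y` on `U_Y(Q̄)^{≤d′}` for arbitrary `ε′ ∈ ℝ_{>0}`" — proved there via
Prop. 1.7 (i), (ii) and Prop. 1.4 (i)–(iii).

For `X = ℙ¹`, `D = [0]+[1]+[∞]` we take `Y = F_e : u^e + w^e = 1 ⊆ ℙ²`, `λ = u^e` (Galois, group
`μ_e²`, index `e` over each cusp; `ω_Y = 𝒪(e − 3)|_Y`, so `ht_{ω_Y} ≈ (e − 3)·ht_{𝒪_{ℙ²}(1)}`,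
Prop. 1.4 (iii)). This file types the target inequality on `F_e` and PROVES the reduction:

* `FermatPoint e` — a point `(u : w : 1)` of `F_e` presented over a number field; `ht` (the
  normalised `ℙ²`-height `(1/[F:ℚ])·h_F(u : w : 1)`, Mathlib `Height.logHeight`), `logDiff`;
* `VojtaFermat e d ε` — "[GenEll] Thm. 2.1 (i) for `(F_e, ∅)` in degree `≤ d`":
  `(e − 3)·ht ≲ (1 + ε)·log-diff` on the points of `F_e` presented over fields of degree `≤ d`
  (a predicate; equivalent to the minimal-field form since `logdisc` is monotone in towers);
* `vojtaP1Deg_of_vojtaFermat` — **Step 1 PROVED**: if `VojtaFermat e d′ ε′` holds for all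
  `e ≥ 4`, `d′`, `ε′ > 0`, then `VojtaP1Deg d` ([GenEll] Thm. 2.1 (i)|_{ℙ¹}, tree `GenEllThm21`) holds
  for every `d ≥ 1`. Inputs: the different bound of the Kummer covering
  (`logdisc_le_of_isSplittingField_kummer`, i.e. Prop. 1.7 (i) for `Y → X`, with Prop. 1.7 (ii)'s
  numerology `deg ω_Y = e(e−3) = e²(1 − 3/e)·deg ω_X(D)` built into the factor `(e−3)/e`), the height
  identities `h(u^e) = e·h(u)`, `h(u : 1) ≤ h(u : w : 1)`, `h_N(x) = [N:K]·h_K(x)` (Prop. 1.4 (i)).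

Remaining for GenEllTwo (`Summit.ABC.ABC.Theses.IUTThetaPilot`): Step 2, i.e. `VojtaFermat` from
`ABCCompactlyBounded {2}` (noncritical Belyi maps on `F_e`, compactness, heights on `F_e`).
-/

noncomputable section

open NumberField IsDedekindDomain Polynomial Height

namespace Literature.NumberTheory.DiophantineGeometry.GenEll

/-- A point `(u : w : 1)` of the Fermat curve `F_e : u^e + w^e = 1` (affine part `z ≠ 0`), presented
over a number field `F`. [cite: MochizukiGenEll2010, Thm 2.1 p.11] -/
structure FermatPoint (e : ℕ) : Type 1 where
  /-- the number field over which the point is presented -/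
  F : Type
  [instField : Field F]
  [instNumberField : NumberField F]
  /-- first affine coordinate -/
  u : F
  /-- second affine coordinate -/
  w : F
  /-- the Fermat equation -/
  rel : u ^ e + w ^ e = 1

namespace FermatPoint

variable {e : ℕ}

/-- Field structure of the presenting field (bundled projection). [cite: MochizukiGenEll2010, Thm 2.1 p.11] -/
instance field (Q : FermatPoint e) : Field Q.F := Q.instField

/-- Number-field structure of the presenting field (bundled projection). [cite: MochizukiGenEll2010, Thm 2.1 p.11] -/
instance numberField (Q : FermatPoint e) : NumberField Q.F := Q.instNumberField

/-- `[F : ℚ]`. [cite: MochizukiGenEll2010, Ex 1.3 (i) p.5] -/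
def degree (Q : FermatPoint e) : ℕ := Module.finrank ℚ Q.F

/-- The normalised `ℙ²`-height `(1/[F:ℚ])·h_F(u : w : 1)` — a representative of `ht_{𝒪(1)|Y}`, so
that `(e−3)·ht` represents `ht_{ω_Y}` (`ω_Y = 𝒪(e−3)|_Y`, Prop. 1.4 (i), (iii)).
[cite: MochizukiGenEll2010, Prop 1.4 (iii) p.6] -/
def ht (Q : FermatPoint e) : ℝ := (Q.degree : ℝ)⁻¹ * logHeight ![Q.u, Q.w, 1]

/-- The log-different `(1/[F:ℚ])·log|disc F|` of the presenting field (Def. 1.5 (iii); for the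
minimal field this is `log-diff_Y` of the point). [cite: MochizukiGenEll2010, Def 1.5 (iii) p.8] -/
def logDiff (Q : FermatPoint e) : ℝ := (Q.degree : ℝ)⁻¹ * Real.log ((discr Q.F).natAbs : ℝ)

/-- `[F:ℚ] ≥ 1`. [cite: MochizukiGenEll2010, Ex 1.3 (i) p.5] -/
theorem degree_pos (Q : FermatPoint e) : 0 < Q.degree := Module.finrank_pos

end FermatPoint

/-- **[GenEll] Thm. 2.1 (i) for the Fermat curve `(Y, D) = (F_e, ∅)` in degree `≤ d`**:
`ht_{ω_Y} ≲ (1+ε)·log-diff_Y` on the points of `F_e` presented over number fields of degree `≤ d`,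
with `ht_{ω_Y}` represented by `(e−3)·ht`. A predicate; asserted by nobody.
[cite: MochizukiGenEll2010, Thm 2.1 (i) p.11] -/
def VojtaFermat (e d : ℕ) (ε : ℝ) : Prop :=
  ∃ C : ℝ, ∀ Q : FermatPoint e, Q.degree ≤ d → ((e : ℝ) - 3) * Q.ht ≤ (1 + ε) * Q.logDiff + C

/-! ## Step 1: `VojtaFermat` for all `e`, `d′`, `ε′` implies `VojtaP1Deg` -/

/-- The height input: for `u ∈ N ⊇ K` with `u^e = x`, `e ≥ 1`:
`(1/e)·(1/[K:ℚ])·h_K(x) ≤ (1/[N:ℚ])·h_N(u : w : 1)`. [cite: MochizukiGenEll2010, Prop 1.4 (i) p.6] -/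
theorem NFPoint.ht_le_fermat_ht (P : NFPoint) (N : Type) [Field N] [NumberField N] [Algebra P.F N]
    {e : ℕ} (he : 0 < e) {u w : N} (hu : u ^ e = algebraMap P.F N P.x) :
    (e : ℝ)⁻¹ * P.ht ≤ (Module.finrank ℚ N : ℝ)⁻¹ * logHeight ![u, w, 1] := by
  have hN : (Module.finrank ℚ N : ℝ) = Module.finrank ℚ P.F * Module.finrank P.F N := by
    exact_mod_cast (Module.finrank_mul_finrank ℚ P.F N).symm
  have hKpos : (0 : ℝ) < Module.finrank ℚ P.F := by exact_mod_cast Module.finrank_pos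
  have hNK : (0 : ℝ) < Module.finrank P.F N := by exact_mod_cast Module.finrank_pos
  have hepos : (0 : ℝ) < e := by exact_mod_cast he
  -- `h_N(x) = [N:K] h_K(x)` and `h(u^e) = e h(u)`
  have h1 : logHeight₁ (algebraMap P.F N P.x) = Module.finrank P.F N * logHeight₁ P.x :=
    NumberField.logHeight₁_algebraMap P.x
  have h2 : logHeight₁ (u ^ e) = e * logHeight₁ u := logHeight₁_pow u e
  -- `h(u : 1) ≤ h(u : w : 1)`
  have h3 : logHeight₁ u ≤ logHeight ![u, w, 1] := by
    rw [logHeight₁_eq_logHeight]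
    have := logHeight_comp_le (![0, 2] : Fin 2 → Fin 3) ![u, w, 1]
    convert this using 2
    ext i; fin_cases i <;> rfl
  have hx : logHeight₁ P.x = (Module.finrank P.F N : ℝ)⁻¹ * (e * logHeight₁ u) := by
    have h' : (Module.finrank P.F N : ℝ) * logHeight₁ P.x = e * logHeight₁ u := by
      rw [← h1, ← hu, h2]
    rw [← h']; field_simp
  unfold NFPoint.ht NFPoint.degree
  rw [hx, hN]
  calc (e : ℝ)⁻¹ * ((Module.finrank ℚ P.F : ℝ)⁻¹ * ((Module.finrank P.F N : ℝ)⁻¹ *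
        (e * logHeight₁ u)))
      = (Module.finrank ℚ P.F * Module.finrank P.F N : ℝ)⁻¹ * logHeight₁ u := by
        field_simp
    _ ≤ (Module.finrank ℚ P.F * Module.finrank P.F N : ℝ)⁻¹ * logHeight ![u, w, 1] :=
        mul_le_mul_of_nonneg_left h3 (by positivity)

/-- **Step 1 of the proof of [GenEll] Thm. 2.1 for `X = ℙ¹`, `D = [0]+[1]+[∞]`** (pp. 11–12):
if for every `e ≥ 4`, every `d′` and every `ε′ > 0` the Vojta inequality holds on the Fermat curve
`F_e` (no boundary) in degree `≤ d′`, then [GenEll] Thm. 2.1 (i) holds for `(ℙ¹, [0]+[1]+[∞])` in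
every degree `d ≥ 1`. Given `ε`, take `e ≥ 4` with `3/(e−3) ≤ ε/2`, `ε′ = ε/(2+ε)`, `d′ = e³ d`;
for `x` of degree `≤ d` the point `(u, w)`, `u^e = x`, `w^e = 1 − x`, of `F_e` over the splitting
field `N` has degree `≤ d′`, `(1/e)·ht(x) ≤ ht(u,w)` and `logdisc N ≤ log-diff(x) + log-cond(x) +
c(e)` (`logdisc_le_of_isSplittingField_kummer`). [cite: MochizukiGenEll2010, Thm 2.1 p.12] -/
theorem vojtaP1Deg_of_vojtaFermat
    (h : ∀ e : ℕ, 4 ≤ e → ∀ d' : ℕ, ∀ ε' : ℝ, 0 < ε' → VojtaFermat e d' ε') (d : ℕ) :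
    VojtaP1Deg d := by
  intro ε hε
  -- choice of `e` and `ε'`
  obtain ⟨m, hm⟩ := exists_nat_gt (6 / ε)
  set e : ℕ := m + 4 with he_def
  have he4 : 4 ≤ e := by omega
  have hepos : 0 < e := by omega
  have heR : (3 : ℝ) < e := by exact_mod_cast (show 3 < e by omega)
  have he3 : (e : ℝ) - 3 > 6 / ε := by
    have : ((m : ℕ) : ℝ) + 4 = (e : ℝ) := by rw [he_def]; push_cast; ring
    linarith
  set ε' : ℝ := ε / (2 + ε) with hε'_def
  have hε' : 0 < ε' := by positivity
  obtain ⟨C₀, hC⟩ := h e he4 (e ^ 3 * d) ε' hε'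
  -- the constant of the Kummer different bound, uniform in the point
  set c : ℝ := Real.log e + Real.log ((e : ℝ) ^ 3) + Real.log (e ^ 3).factorial with hc_def
  -- the coefficient `(e/(e-3))·(1+ε') ≤ 1 + ε`
  have hcoef : (e : ℝ) / ((e : ℝ) - 3) * (1 + ε') ≤ 1 + ε := by
    have h3e : 0 < (e : ℝ) - 3 := by linarith
    have hA : (e : ℝ) / ((e : ℝ) - 3) ≤ 1 + ε / 2 := by
      rw [div_le_iff₀ h3e]
      have : 3 ≤ (ε / 2) * ((e : ℝ) - 3) := by
        have h6 : 6 / ε < (e : ℝ) - 3 := he3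
        have : 6 < ε * ((e : ℝ) - 3) := by rwa [div_lt_iff₀ hε, mul_comm] at h6
        linarith
      linarith
    have hB : (1 + ε / 2) * (1 + ε') = 1 + ε := by
      rw [hε'_def]; field_simp; ring
    calc (e : ℝ) / ((e : ℝ) - 3) * (1 + ε') ≤ (1 + ε / 2) * (1 + ε') :=
          mul_le_mul_of_nonneg_right hA (by linarith)
      _ = 1 + ε := hB
  refine ⟨(e : ℝ) / ((e : ℝ) - 3) * ((1 + ε') * c + C₀), fun P hP => ?_⟩
  obtain ⟨-, hPle⟩ := hP
  have hPU : P.InU := hPle.1.1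
  have hPd : P.degree ≤ d := hPle.2
  -- the splitting field and the Fermat point over it
  let N : Type := ((X ^ e - 1) * ((X ^ e - C P.x) * (X ^ e - C (1 - P.x))) : P.F[X]).SplittingField
  haveI : NumberField N := NumberField.of_module_finite P.F N
  obtain ⟨⟨u, hu⟩, ⟨w, hw⟩⟩ := exists_pow_eq N P.x hepos
  have hrel : u ^ e + w ^ e = 1 := by rw [hu, hw, ← map_add, add_sub_cancel, map_one]
  let Q : FermatPoint e := ⟨N, u, w, hrel⟩
  have hQdeg : Q.degree ≤ e ^ 3 * d := by
    change Module.finrank ℚ N ≤ e ^ 3 * d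
    rw [← Module.finrank_mul_finrank ℚ P.F N, mul_comm]
    exact Nat.mul_le_mul (finrank_le_of_isSplittingField_kummer P N hPU hepos) hPd
  have hV := hC Q hQdeg
  -- the two comparisons
  have hht : (e : ℝ)⁻¹ * P.ht ≤ Q.ht := P.ht_le_fermat_ht N hepos (w := w) hu
  have hdisc : Q.logDiff ≤ P.logDiff + P.logCond + c := by
    have h0 := logdisc_le_of_isSplittingField_kummer P N hPU hepos
    have hn := finrank_le_of_isSplittingField_kummer P N hPU hepos
    have hn1 : 1 ≤ Module.finrank P.F N := Module.finrank_pos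
    have hlogn : Real.log (Module.finrank P.F N) ≤ Real.log ((e : ℝ) ^ 3) :=
      Real.log_le_log (by exact_mod_cast hn1) (by exact_mod_cast hn)
    have hlogf : Real.log (Module.finrank P.F N).factorial ≤ Real.log (e ^ 3).factorial :=
      Real.log_le_log (by exact_mod_cast Nat.factorial_pos _)
        (by exact_mod_cast Nat.factorial_le hn)
    change (Module.finrank ℚ N : ℝ)⁻¹ * Real.log ((discr N).natAbs : ℝ) ≤ _
    rw [hc_def]
    linarith
  -- assemble
  have h3e : 0 < (e : ℝ) - 3 := by linarith
  have hsum : 0 ≤ P.logDiff + P.logCond := add_nonneg P.logDiff_nonneg P.logCond_nonneg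
  have heR0 : (0 : ℝ) < e := by exact_mod_cast hepos
  -- from `hV`: `((e-3)/e)·ht(P) ≤ (1+ε')(logDiff + logCond + c) + C₀`
  have h5 : ((e : ℝ) - 3) * ((e : ℝ)⁻¹ * P.ht) ≤ (1 + ε') * (P.logDiff + P.logCond + c) + C₀ := by
    calc ((e : ℝ) - 3) * ((e : ℝ)⁻¹ * P.ht) ≤ ((e : ℝ) - 3) * Q.ht :=
          mul_le_mul_of_nonneg_left hht h3e.le
      _ ≤ (1 + ε') * Q.logDiff + C₀ := hV
      _ ≤ (1 + ε') * (P.logDiff + P.logCond + c) + C₀ := by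
          have : 0 ≤ 1 + ε' := by linarith
          nlinarith
  have h6 : P.ht ≤ (e : ℝ) / ((e : ℝ) - 3) * ((1 + ε') * (P.logDiff + P.logCond + c) + C₀) := by
    have hlhs : ((e : ℝ) - 3) * ((e : ℝ)⁻¹ * P.ht) = P.ht / ((e : ℝ) / ((e : ℝ) - 3)) := by
      field_simp
    rw [hlhs, div_le_iff₀ (by positivity)] at h5
    linarith [h5]
  have h7 : (e : ℝ) / ((e : ℝ) - 3) * ((1 + ε') * (P.logDiff + P.logCond + c) + C₀) =
      (e : ℝ) / ((e : ℝ) - 3) * (1 + ε') * (P.logDiff + P.logCond) +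
        (e : ℝ) / ((e : ℝ) - 3) * ((1 + ε') * c + C₀) := by ring
  rw [h7] at h6
  have h8 : (e : ℝ) / ((e : ℝ) - 3) * (1 + ε') * (P.logDiff + P.logCond) ≤
      (1 + ε) * (P.logDiff + P.logCond) := mul_le_mul_of_nonneg_right hcoef hsum
  linarith

end Literature.NumberTheory.DiophantineGeometry.GenEll

end
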